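import Mathlib
import HarnessLib

/-!
# Mollification of Lipschitz functions on a finite-dimensional space (toolkit)

Topic `Literature/Analysis/PDE`. Proved real-analysis lemmas (no definitions of notions, no named
facts) forming the first layer of the formalization of the weak–strong uniqueness theorem of
Dafermos (`Literature.Analysis.PDE.ConservationLaw.dafermos_weak_strong_uniqueness`, Dafermos,
*Hyperbolic Conservation Laws in Continuum Physics* (2000), Thm 5.2.1). Dafermos' definitions of
weak / admissible solutions ((4.1.6), (4.3.4)) use LIPSCHITZ test functions, the tree's
`IsWeakSolution` / `IsEntropyAdmissible` use `C¹` ones; the passage from the latter to the former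
is by mollification, whose elementary theory on a finite-dimensional real normed space `V` with an
additive Haar measure `μ` is recorded here (generalising the `ℝ × ℝ` toolkit of
`Literature/Analysis/PDE/SingleEntropy/Mollify.lean`):

* `mollify_apply`, `contDiff_mollify`, `mollify_eq_zero_of_forall_ball`, `abs_mollify_le`,
  `mollify_nonneg`, `dist_mollify_le_of_lipschitz` — the mollification `ρ.normed μ ⋆ g` by a
  normed bump `ρ : ContDiffBump (0 : V)`;
* `fderiv_mollify_apply` — `D(ρ̄ ⋆ g)(p)v = ∫ Dρ̄(p - z)v g(z) dz`;
* `fderiv_mollify_eq_mollify_fderiv` — for LIPSCHITZ `g`, `D(ρ̄ ⋆ g)v = ρ̄ ⋆ (Dg · v)` where `Dg`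
  is the a.e.-defined Fréchet derivative (Rademacher), by Mathlib's integration by parts for
  Lipschitz functions (`LipschitzWith.integral_lineDeriv_mul_eq`); hence `|D(ρ̄ ⋆ g)v| ≤ K‖v‖`;
* `exists_bumpSeq` — bumps of radii `(1/(2(k+1)), 1/(k+1))`, and the two convergence statements
  `tendsto_mollify_of_lipschitz` (uniform, for Lipschitz `g`) and `ae_tendsto_fderiv_mollify`
  (a.e. convergence of `D(ρ̄_k ⋆ g)v` to `Dg v`, Lebesgue differentiation via Mathlib's
  `ContDiffBump.ae_convolution_tendsto_right_of_locallyIntegrable`).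

No `def` is introduced (theorems only).

All statements are standard real analysis. [folklore]

## References

* C. M. Dafermos, *Hyperbolic Conservation Laws in Continuum Physics*, Springer 2000, §4.1
  (Lipschitz test functions in (4.1.6)) [Dafermos2000].
* L. C. Evans, *Partial Differential Equations*, 2nd ed., App. C.4 (mollifiers) and §5.8.2–5.8.3
  (Lipschitz functions, Rademacher) [Evans2010].
-/

noncomputable section

open MeasureTheory Set Filter Metric ContinuousLinearMap
open scoped Topology Convolution NNReal

namespace Literature.Analysis.PDE.ConservationLaw

section Mollifier

variable {V : Type*} [NormedAddCommGroup V] [NormedSpace ℝ V] [FiniteDimensional ℝ V]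
  [MeasurableSpace V] [BorelSpace V] {μ : Measure V} [μ.IsAddHaarMeasure]
variable (ρ : ContDiffBump (0 : V))

/-! ## Bounded measurable functions -/

omit [NormedSpace ℝ V] [FiniteDimensional ℝ V] [BorelSpace V] [μ.IsAddHaarMeasure] in
/-- A bounded (a.e. strongly) measurable function is locally integrable for a locally finite
measure. [folklore] -/
theorem locallyIntegrable_of_norm_le [IsLocallyFiniteMeasure μ] {F : Type*}
    [NormedAddCommGroup F] {g : V → F} (hg : AEStronglyMeasurable g μ) {M : ℝ}
    (hgM : ∀ z, ‖g z‖ ≤ M) : LocallyIntegrable g μ := by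
  intro x
  obtain ⟨U, hU, hUf⟩ := μ.exists_isOpen_measure_lt_top x
  refine ⟨U, hUf.1.mem_nhds hU, ?_⟩
  exact Measure.integrableOn_of_bounded hUf.2.ne hg (ae_of_all _ fun z => hgM z)

/-! ## The mollification `ρ̄ ⋆ g` -/

/-- Integral formula for the mollification. [folklore] -/
theorem mollify_apply (g : V → ℝ) (p : V) :
    (ρ.normed μ ⋆[lsmul ℝ ℝ, μ] g) p = ∫ z, ρ.normed μ (p - z) * g z ∂μ := by
  rw [convolution_eq_swap]
  simp [lsmul_apply, smul_eq_mul]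

/-- The mollification of a locally integrable function is smooth. [folklore] -/
theorem contDiff_mollify {g : V → ℝ} (hg : LocallyIntegrable g μ) {k : ℕ∞} :
    ContDiff ℝ k (ρ.normed μ ⋆[lsmul ℝ ℝ, μ] g) :=
  ρ.hasCompactSupport_normed.contDiff_convolution_left (lsmul ℝ ℝ) ρ.contDiff_normed hg

/-- The reflected bump `z ↦ ρ̄ (p - z)` vanishes outside `ball p rOut`. [folklore] -/
theorem normed_sub_eq_zero {p z : V} (hz : z ∉ ball p ρ.rOut) :
    ρ.normed μ (p - z) = 0 := by
  have : p - z ∉ Function.support (ρ.normed μ) := by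
    rw [ρ.support_normed_eq]
    intro h
    apply hz
    rw [mem_ball_zero_iff] at h
    rwa [mem_ball, dist_eq_norm, ← norm_sub_rev]
  simpa [Function.mem_support] using this

/-- Locality: if `g` vanishes on `ball p rOut` then `(ρ̄ ⋆ g)(p) = 0`. [folklore] -/
theorem mollify_eq_zero_of_forall_ball {g : V → ℝ} {p : V}
    (h : ∀ z ∈ ball p ρ.rOut, g z = 0) : (ρ.normed μ ⋆[lsmul ℝ ℝ, μ] g) p = 0 := by
  rw [mollify_apply]
  refine integral_eq_zero_of_ae (ae_of_all _ fun z => ?_)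
  by_cases hz : z ∈ ball p ρ.rOut
  · simp [h z hz]
  · simp [normed_sub_eq_zero ρ hz]

/-- The support of a mollification lies in the `rOut`-thickening of the support. [folklore] -/
theorem support_mollify_subset (g : V → ℝ) :
    Function.support (ρ.normed μ ⋆[lsmul ℝ ℝ, μ] g) ⊆ thickening ρ.rOut (tsupport g) := by
  intro p hp
  by_contra hpt
  apply hp
  apply mollify_eq_zero_of_forall_ball
  intro z hz
  by_contra hgz
  apply hpt
  rw [mem_thickening_iff]
  exact ⟨z, subset_tsupport _ hgz, by rw [dist_comm]; exact hz⟩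

/-- The topological support of a mollification lies in the closed `rOut`-thickening of the
support. [folklore] -/
theorem tsupport_mollify_subset (g : V → ℝ) :
    tsupport (ρ.normed μ ⋆[lsmul ℝ ℝ, μ] g) ⊆ cthickening ρ.rOut (tsupport g) :=
  (closure_mono (support_mollify_subset ρ g)).trans
    (closure_thickening_subset_cthickening _ _)

/-- The mollification of a compactly supported function by a bump of outer radius `≤ 1` is
supported in the (compact) closed unit thickening of the support. [folklore] -/
theorem hasCompactSupport_mollify {g : V → ℝ} (hg : HasCompactSupport g) (hρ : ρ.rOut ≤ 1) :
    HasCompactSupport (ρ.normed μ ⋆[lsmul ℝ ℝ, μ] g) := by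
  refine HasCompactSupport.of_support_subset_isCompact (hg.isCompact.cthickening (r := 1)) ?_
  exact ((support_mollify_subset ρ g).trans (thickening_subset_cthickening _ _)).trans
    (cthickening_mono hρ _)

/-- The mollification of a function bounded by `M` is bounded by `M`. [folklore] -/
theorem abs_mollify_le {g : V → ℝ} {M : ℝ} (hgM : ∀ z, |g z| ≤ M) (p : V) :
    |(ρ.normed μ ⋆[lsmul ℝ ℝ, μ] g) p| ≤ M := by
  rw [mollify_apply]
  have h1 : ∫ z, ρ.normed μ (p - z) ∂μ = (1 : ℝ) := by
    rw [integral_sub_left_eq_self (fun z => ρ.normed μ z) μ p]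
    exact ρ.integral_normed
  have hint : Integrable (fun z => ρ.normed μ (p - z)) μ :=
    (ρ.integrable_normed (μ := μ)).comp_sub_left p
  calc |∫ z, ρ.normed μ (p - z) * g z ∂μ|
      ≤ ∫ z, |ρ.normed μ (p - z) * g z| ∂μ := abs_integral_le_integral_abs
    _ ≤ ∫ z, ρ.normed μ (p - z) * M ∂μ := by
        apply integral_mono_of_nonneg (ae_of_all _ fun z => abs_nonneg _) (hint.mul_const M)
        refine ae_of_all _ fun z => ?_
        dsimp only
        rw [abs_mul, abs_of_nonneg (ρ.nonneg_normed _)]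
        exact mul_le_mul_of_nonneg_left (hgM z) (ρ.nonneg_normed _)
    _ = M := by rw [integral_mul_const, h1, one_mul]

/-- The mollification of a nonnegative function is nonnegative. [folklore] -/
theorem mollify_nonneg {g : V → ℝ} (hg : ∀ z, 0 ≤ g z) (p : V) :
    0 ≤ (ρ.normed μ ⋆[lsmul ℝ ℝ, μ] g) p := by
  rw [mollify_apply]
  exact integral_nonneg fun z => mul_nonneg (ρ.nonneg_normed _) (hg z)

/-- Rate of convergence of the mollification of a Lipschitz function:
`|(ρ̄ ⋆ g)(p) - g(p)| ≤ K rOut`. [folklore] -/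
theorem dist_mollify_le_of_lipschitz {g : V → ℝ} {K : ℝ≥0}
    (hg : LipschitzWith K g) (p : V) :
    dist ((ρ.normed μ ⋆[lsmul ℝ ℝ, μ] g) p) (g p) ≤ K * ρ.rOut := by
  refine ρ.dist_normed_convolution_le hg.continuous.aestronglyMeasurable fun z hz => ?_
  calc dist (g z) (g p) ≤ K * dist z p := hg.dist_le_mul z p
    _ ≤ K * ρ.rOut := by
        rw [mem_ball] at hz
        exact mul_le_mul_of_nonneg_left hz.le K.2

/-! ## Derivatives of mollifications -/

/-- Derivative of the mollification: `D(ρ̄ ⋆ g)(p) v = ∫ Dρ̄ (p - z) v g(z) dz`. [folklore] -/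
theorem fderiv_mollify_apply {g : V → ℝ} (hg : LocallyIntegrable g μ) (p v : V) :
    fderiv ℝ (ρ.normed μ ⋆[lsmul ℝ ℝ, μ] g) p v
      = ∫ z, fderiv ℝ (ρ.normed μ) (p - z) v * g z ∂μ := by
  have H := (ρ.hasCompactSupport_normed (μ := μ)).hasFDerivAt_convolution_left
    (lsmul ℝ ℝ) (ρ.contDiff_normed (n := 1)) hg p
  rw [H.fderiv, ← convolution_flip]
  have e : ((lsmul ℝ ℝ : ℝ →L[ℝ] ℝ →L[ℝ] ℝ).precompL V).flip
      = (lsmul ℝ ℝ : ℝ →L[ℝ] ℝ →L[ℝ] ℝ).flip.precompR V := by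
    rw [ContinuousLinearMap.precompL, ContinuousLinearMap.flip_flip]
  rw [e, convolution_precompR_apply _ hg ((ρ.hasCompactSupport_normed (μ := μ)).fderiv ℝ)
    ((ρ.contDiff_normed (n := 1)).continuous_fderiv one_ne_zero), convolution_def]
  simp only [flip_apply, lsmul_apply, smul_eq_mul]

omit [BorelSpace V] [μ.IsAddHaarMeasure] in
/-- Derivative of the reflected bump. [folklore] -/
theorem fderiv_normed_sub_apply (p z v : V) :
    fderiv ℝ (fun z => ρ.normed μ (p - z)) z v = -(fderiv ℝ (ρ.normed μ) (p - z) v) := by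
  have h1 : HasFDerivAt (fun z : V => p - z) (0 - ContinuousLinearMap.id ℝ V) z :=
    (hasFDerivAt_const p z).sub (hasFDerivAt_id z)
  have h2 : HasFDerivAt (ρ.normed μ) (fderiv ℝ (ρ.normed μ) (p - z)) (p - z) :=
    ((ρ.contDiff_normed (n := 1)).differentiable one_ne_zero _).hasFDerivAt
  have h3 : HasFDerivAt (fun z => ρ.normed μ (p - z))
      ((fderiv ℝ (ρ.normed μ) (p - z)).comp (0 - ContinuousLinearMap.id ℝ V)) z :=
    h2.comp z h1
  rw [h3.fderiv]
  simp

/-- The reflected bump has compact support. [folklore] -/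
theorem hasCompactSupport_normed_sub (p : V) :
    HasCompactSupport (fun z => ρ.normed μ (p - z)) := by
  refine HasCompactSupport.of_support_subset_isCompact (isCompact_closedBall p ρ.rOut) ?_
  intro z hz
  by_contra h
  exact hz (normed_sub_eq_zero ρ (fun h' => h (ball_subset_closedBall h')))

/-- **Derivatives of the mollification of a Lipschitz function**: for `g` Lipschitz,
`D(ρ̄ ⋆ g)(p) v = ∫ ρ̄(p - z) ∂ᵥg(z) dz`, where `∂ᵥg = lineDeriv ℝ g · v` exists a.e.
(Rademacher); integration by parts for Lipschitz functions
(`LipschitzWith.integral_lineDeriv_mul_eq`). [folklore] -/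
theorem fderiv_mollify_of_lipschitz {g : V → ℝ} {K : ℝ≥0} (hg : LipschitzWith K g) (p v : V) :
    fderiv ℝ (ρ.normed μ ⋆[lsmul ℝ ℝ, μ] g) p v
      = ∫ z, ρ.normed μ (p - z) * lineDeriv ℝ g z v ∂μ := by
  have hk1 : ContDiff ℝ 1 (fun z => ρ.normed μ (p - z)) :=
    (ρ.contDiff_normed (n := 1)).comp (contDiff_const.sub contDiff_id)
  have hkc := hasCompactSupport_normed_sub ρ (μ := μ) p
  obtain ⟨D, hD⟩ := hk1.lipschitzWith_of_hasCompactSupport hkc one_ne_zero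
  have key := hg.integral_lineDeriv_mul_eq (μ := μ) hD hkc v
  have hL : ∀ z, lineDeriv ℝ (fun z => ρ.normed μ (p - z)) z (-v)
      = fderiv ℝ (ρ.normed μ) (p - z) v := by
    intro z
    rw [((hk1.differentiable one_ne_zero) z).lineDeriv_eq_fderiv, map_neg,
      fderiv_normed_sub_apply, neg_neg]
  rw [fderiv_mollify_apply ρ hg.continuous.locallyIntegrable]
  simp_rw [hL] at key
  rw [← key]
  congr 1
  funext z
  ring

/-- For Lipschitz `g` the derivative of the mollification is the mollification of the
(a.e.-defined) derivative: `D(ρ̄ ⋆ g)(p) v = (ρ̄ ⋆ (Dg · v))(p)`. [folklore] -/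
theorem fderiv_mollify_eq_mollify_fderiv {g : V → ℝ} {K : ℝ≥0} (hg : LipschitzWith K g)
    (p v : V) :
    fderiv ℝ (ρ.normed μ ⋆[lsmul ℝ ℝ, μ] g) p v
      = (ρ.normed μ ⋆[lsmul ℝ ℝ, μ] (fun z => fderiv ℝ g z v)) p := by
  rw [fderiv_mollify_of_lipschitz ρ hg, mollify_apply]
  refine integral_congr_ae ?_
  filter_upwards [hg.ae_differentiableAt (μ := μ)] with z hz
  rw [hz.lineDeriv_eq_fderiv]

omit [FiniteDimensional ℝ V] [MeasurableSpace V] [BorelSpace V] in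
/-- The a.e.-defined derivative of a `K`-Lipschitz function is bounded by `K‖v‖`. [folklore] -/
theorem abs_fderiv_apply_le_of_lipschitz {g : V → ℝ} {K : ℝ≥0} (hg : LipschitzWith K g)
    (z v : V) : |fderiv ℝ g z v| ≤ K * ‖v‖ := by
  rw [← Real.norm_eq_abs]
  exact (le_opNorm _ _).trans (mul_le_mul_of_nonneg_right (norm_fderiv_le_of_lipschitz ℝ hg)
    (norm_nonneg _))

/-- For `K`-Lipschitz `g`, `|D(ρ̄ ⋆ g)(p) v| ≤ K ‖v‖`. [folklore] -/
theorem abs_fderiv_mollify_le {g : V → ℝ} {K : ℝ≥0} (hg : LipschitzWith K g) (p v : V) :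
    |fderiv ℝ (ρ.normed μ ⋆[lsmul ℝ ℝ, μ] g) p v| ≤ K * ‖v‖ := by
  rw [fderiv_mollify_eq_mollify_fderiv ρ hg]
  exact abs_mollify_le ρ (fun z => abs_fderiv_apply_le_of_lipschitz hg z v) p

omit [FiniteDimensional ℝ V] in
/-- The a.e.-defined directional derivative `z ↦ Dg(z) v` of a Lipschitz function is measurable.
[folklore] -/
theorem measurable_fderiv_apply (g : V → ℝ) (v : V) :
    Measurable fun z => fderiv ℝ g z v :=
  measurable_fderiv_apply_const ℝ g v

/-- The a.e.-defined directional derivative of a Lipschitz function is locally integrable.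
[folklore] -/
theorem locallyIntegrable_fderiv_apply {g : V → ℝ} {K : ℝ≥0} (hg : LipschitzWith K g) (v : V) :
    LocallyIntegrable (fun z => fderiv ℝ g z v) μ :=
  locallyIntegrable_of_norm_le (measurable_fderiv_apply g v).aestronglyMeasurable
    (M := K * ‖v‖) fun z => by
      rw [Real.norm_eq_abs]; exact abs_fderiv_apply_le_of_lipschitz hg z v

/-! ## Shrinking bumps and the two convergence statements -/

omit [NormedSpace ℝ V] [FiniteDimensional ℝ V] [MeasurableSpace V] [BorelSpace V] in
/-- A sequence of bumps centred at `0` with radii `rIn = 1/(2(k+1))`, `rOut = 1/(k+1)`: outer radii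
tend to `0`, are at most `1`, and `rOut ≤ 2 rIn`. [folklore] -/
theorem exists_bumpSeq : ∃ ρs : ℕ → ContDiffBump (0 : V),
    Tendsto (fun k => (ρs k).rOut) atTop (𝓝 0) ∧ (∀ k, (ρs k).rOut ≤ 2 * (ρs k).rIn) ∧
      (∀ k, (ρs k).rOut ≤ 1) ∧ ∀ k, (ρs k).rOut = 1 / ((k : ℝ) + 1) := by
  have hpos : ∀ k : ℕ, (0 : ℝ) < (k : ℝ) + 1 := fun k => by positivity
  have h1 : ∀ k : ℕ, (0 : ℝ) < 1 / (2 * ((k : ℝ) + 1)) := fun k => by positivity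
  have h2 : ∀ k : ℕ, 1 / (2 * ((k : ℝ) + 1)) < 1 / ((k : ℝ) + 1) := fun k =>
    one_div_lt_one_div_of_lt (hpos k) (by linarith [hpos k])
  refine ⟨fun k => ⟨1 / (2 * ((k : ℝ) + 1)), 1 / ((k : ℝ) + 1), h1 k, h2 k⟩, ?_, ?_, ?_, ?_⟩
  · exact tendsto_one_div_add_atTop_nhds_zero_nat
  · intro k
    change 1 / ((k : ℝ) + 1) ≤ 2 * (1 / (2 * ((k : ℝ) + 1)))
    rw [mul_one_div, ← div_div, div_self (two_ne_zero)]
  · intro k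
    change 1 / ((k : ℝ) + 1) ≤ 1
    rw [div_le_one (hpos k)]
    linarith [(Nat.cast_nonneg k : (0 : ℝ) ≤ k)]
  · intro k
    rfl

/-- **Lebesgue differentiation for mollifications**: for locally integrable `g` and bumps with
`rOut → 0`, `rOut ≤ 2 rIn`, `(ρ̄_k ⋆ g)(p) → g(p)` for a.e. `p`. [folklore] -/
theorem ae_tendsto_mollify {ρs : ℕ → ContDiffBump (0 : V)}
    (hr : Tendsto (fun k => (ρs k).rOut) atTop (𝓝 0)) (hr2 : ∀ k, (ρs k).rOut ≤ 2 * (ρs k).rIn)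
    {g : V → ℝ} (hg : LocallyIntegrable g μ) :
    ∀ᵐ p ∂μ, Tendsto (fun k => ((ρs k).normed μ ⋆[lsmul ℝ ℝ, μ] g) p) atTop (𝓝 (g p)) :=
  ContDiffBump.ae_convolution_tendsto_right_of_locallyIntegrable hr (Eventually.of_forall hr2) hg

/-- **A.e. convergence of the derivatives of the mollifications of a Lipschitz function**:
`D(ρ̄_k ⋆ g)(p) v → Dg(p) v` for a.e. `p`. [folklore] -/
theorem ae_tendsto_fderiv_mollify {ρs : ℕ → ContDiffBump (0 : V)}
    (hr : Tendsto (fun k => (ρs k).rOut) atTop (𝓝 0)) (hr2 : ∀ k, (ρs k).rOut ≤ 2 * (ρs k).rIn)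
    {g : V → ℝ} {K : ℝ≥0} (hg : LipschitzWith K g) (v : V) :
    ∀ᵐ p ∂μ, Tendsto (fun k => fderiv ℝ ((ρs k).normed μ ⋆[lsmul ℝ ℝ, μ] g) p v) atTop
      (𝓝 (fderiv ℝ g p v)) := by
  filter_upwards [ae_tendsto_mollify hr hr2 (locallyIntegrable_fderiv_apply hg v (μ := μ))]
    with p hp
  simp_rw [fderiv_mollify_eq_mollify_fderiv _ hg]
  exact hp

/-- **Uniform convergence of the mollifications of a Lipschitz function**:
`|(ρ̄_k ⋆ g)(p) - g(p)| ≤ K rOut_k → 0` for every `p`. [folklore] -/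
theorem tendsto_mollify_of_lipschitz {ρs : ℕ → ContDiffBump (0 : V)}
    (hr : Tendsto (fun k => (ρs k).rOut) atTop (𝓝 0)) {g : V → ℝ} {K : ℝ≥0}
    (hg : LipschitzWith K g) (p : V) :
    Tendsto (fun k => ((ρs k).normed μ ⋆[lsmul ℝ ℝ, μ] g) p) atTop (𝓝 (g p)) := by
  rw [tendsto_iff_dist_tendsto_zero]
  have h : Tendsto (fun k => (K : ℝ) * (ρs k).rOut) atTop (𝓝 0) := by
    simpa using hr.const_mul (K : ℝ)
  exact squeeze_zero (fun k => dist_nonneg) (fun k => dist_mollify_le_of_lipschitz _ hg p) h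

end Mollifier

end Literature.Analysis.PDE.ConservationLaw
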